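import Mathlib
import HarnessLib
import Summits.ValiantsHypothesis.ValiantsHypothesis.Theorems.LacunarySymmetroidMatrixDescartesProductPlusOneEulerSharpK
import Summits.ValiantsHypothesis.ValiantsHypothesis.Theorems.LacunarySymmetroidMatrixDescartesProductPlusOneCoherentCopositivity

/-!
# ValiantsHypothesis / LacunarySymmetroid — crux `MatrixDescartes` (stmt-ValiantsHypothesis-18050, V1),
# LINE (A) «product_plus_one», S5 Euler currency: the COHERENT ONE-ZERO SECTOR FOR EVERY K

Builds on ✓/⧗ `…ProductPlusOneCoherentCopositivity` (`coherent_form_neg`, the strict copositivity certificate with the 4-parameter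
`pair_lemma`) and ✓ `…EulerSharpK` (`euler_pos_roots_le_general`, `eulerNumerator_eq_general`), in p7 g14's range-indexed shape
`f = Σ_{i ≤ T} c_i X^{d_i}`, `d` strictly increasing:

* `coherent_quadratic_identity` — `(Σ u_i)(Σ δ_i(δ_i − w) u_i) − (Σ δ_i u_i)² = Σ_i Σ_{i'} ((δ_i − δ_{i'})² − w(δ_i + δ_{i'}))/2 · u_i u_{i'}`;
* `hasDerivAt_coherentXi_neg` — for a COHERENT factor (`c_0 c_i > 0` for `i < T`, `c_0 c_T < 0`) and the integer weight `w = d_{T−1} − d_0`,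
  the function `Ξ(x) = (X f′ − d_0 f)(x) / (x^w f(x))` has a NEGATIVE derivative at every `x > 0` with `f(x) ≠ 0`.

* `coherent_pos_roots_le_one` / `prod_coherent_pos_roots_le` — a coherent factor has at most ONE positive zero (`f/x^{d_T}` is strictly
  monotone), the product at most `m`;
* ★ `coherentK_euler_pos_roots` — `m` coherent `(T+1)`-nomials on a common support (`T ≥ 2`), bottom coupling: `Z₊(X·P′ − (m d_0)·P) ≤ 2m + 1`
  (Rolle for `Σ_j Ξ_j` + ✓ `euler_pos_roots_le_general`);
* ★★ `eulerBound_coherentK` — LINE SHAPE, EVERY FORMAT `K ≥ 3`, every strictly increasing support, bottom coupling `l₀ = 0`, every factor with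
  its single sign change at the TOP letter: `Z₊(eulerNumerator d a 0) ≤ 2m + 1` — a LINEAR row of `EulerBoundPoly` (members ≤ 2m + 2 via
  ✓ `card_pos_roots_class_le_euler`).  K = 3 is ✓ `…CoherentSector` (p663379); the top-letter mirror follows by reversal (not typed here).

Honest framing: a sector of the research stub for every K; NOT `stub_polyLaw` / `stub_eulerBoundK3` / `MatrixDescartes` / B; `VP ≠ VNP`
NOT proved.  No definitions, no named facts.
-/

set_option linter.dupNamespace false

namespace Summit.ValiantsHypothesis.ValiantsHypothesis.Theorems.LacunarySymmetroidMatrixDescartes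

namespace ProductPlusOne

open Polynomial Finset
open scoped BigOperators

/-! ### §A The quadratic identity -/

/-- `(Σ u)(Σ δ(δ−w)u) − (Σ δu)² = Σ_i Σ_{i'} ((δ_i − δ_{i'})² − w(δ_i+δ_{i'}))/2 · u_i u_{i'}`. [folklore] -/
theorem coherent_quadratic_identity (n : ℕ) (δ u : ℕ → ℝ) (w : ℝ) :
    (∑ i ∈ range n, u i) * (∑ i ∈ range n, δ i * (δ i - w) * u i) - (∑ i ∈ range n, δ i * u i) ^ 2
      = ∑ i ∈ range n, ∑ i' ∈ range n, ((δ i - δ i') ^ 2 - w * (δ i + δ i')) / 2 * (u i * u i') := by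
  -- both sides as double sums; symmetrise the left one
  have hL : (∑ i ∈ range n, u i) * (∑ i ∈ range n, δ i * (δ i - w) * u i) - (∑ i ∈ range n, δ i * u i) ^ 2
      = ∑ i ∈ range n, ∑ i' ∈ range n, (δ i' * (δ i' - w) - δ i * δ i') * (u i * u i') := by
    rw [sq, Finset.sum_mul_sum, Finset.sum_mul_sum, ← Finset.sum_sub_distrib]
    refine Finset.sum_congr rfl fun i _ => ?_
    rw [← Finset.sum_sub_distrib]
    refine Finset.sum_congr rfl fun i' _ => by ring
  have hsymm : ∑ i ∈ range n, ∑ i' ∈ range n, (δ i' * (δ i' - w) - δ i * δ i') * (u i * u i')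
      = ∑ i ∈ range n, ∑ i' ∈ range n, (δ i * (δ i - w) - δ i' * δ i) * (u i * u i') := by
    rw [Finset.sum_comm]
    refine Finset.sum_congr rfl fun i _ => Finset.sum_congr rfl fun i' _ => by ring
  rw [hL]
  have h2 : ∑ i ∈ range n, ∑ i' ∈ range n, (δ i' * (δ i' - w) - δ i * δ i') * (u i * u i')
      + ∑ i ∈ range n, ∑ i' ∈ range n, (δ i * (δ i - w) - δ i' * δ i) * (u i * u i')
      = 2 * ∑ i ∈ range n, ∑ i' ∈ range n, ((δ i - δ i') ^ 2 - w * (δ i + δ i')) / 2 * (u i * u i') := by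
    rw [Finset.mul_sum, ← Finset.sum_add_distrib]
    refine Finset.sum_congr rfl fun i _ => ?_
    rw [Finset.mul_sum, ← Finset.sum_add_distrib]
    refine Finset.sum_congr rfl fun i' _ => by ring
  rw [← hsymm] at h2
  linarith

/-! ### §B The derivative of `Ξ = (X f′ − d₀ f)/(x^w f)` is negative for a coherent factor -/

/-- ★ For a COHERENT sparse factor `f = Σ_{i ≤ T} c_i X^{d_i}` (`T ≥ 2`, `d` strictly increasing, `c_0 c_i > 0` for `i < T`, `c_0 c_T < 0`)
and the integer weight `w = d_{T−1} − d_0`: at every `x > 0` with `f(x) ≠ 0`, `Ξ(y) = (X f′ − d_0 f)(y) / (y^w f(y))` has a negative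
derivative. [this file's theorem] -/
theorem hasDerivAt_coherentXi_neg (T : ℕ) (hT : 2 ≤ T) (d : ℕ → ℕ) (hd : StrictMono d) (c : ℕ → ℝ)
    (hcoh : ∀ i, i < T → 0 < c 0 * c i) (htop : c 0 * c T < 0) {x : ℝ} (hx : 0 < x)
    (hf : (∑ i ∈ Finset.range (T + 1), C (c i) * X ^ (d i) : ℝ[X]).eval x ≠ 0) :
    ∃ D : ℝ, D < 0 ∧ HasDerivAt (fun y : ℝ =>
      (X * derivative (∑ i ∈ Finset.range (T + 1), C (c i) * X ^ (d i) : ℝ[X])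
          - C ((d 0 : ℕ) : ℝ) * ∑ i ∈ Finset.range (T + 1), C (c i) * X ^ (d i)).eval y
        / (y ^ (d (T - 1) - d 0) * (∑ i ∈ Finset.range (T + 1), C (c i) * X ^ (d i) : ℝ[X]).eval y)) D x := by
  classical
  set f : ℝ[X] := ∑ i ∈ Finset.range (T + 1), C (c i) * X ^ (d i) with hfdef
  set N₀ : ℝ[X] := X * derivative f - C ((d 0 : ℕ) : ℝ) * f with hN₀
  set w : ℕ := d (T - 1) - d 0 with hw
  have hd0T : d 0 ≤ d (T - 1) := hd.monotone (by omega)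
  have hwR : (w : ℝ) = (d (T - 1) : ℝ) - d 0 := by rw [hw, Nat.cast_sub hd0T]
  have hV : x ^ w * f.eval x ≠ 0 := mul_ne_zero (pow_ne_zero _ hx.ne') hf
  have hnum : HasDerivAt (fun y : ℝ => N₀.eval y) ((derivative N₀).eval x) x := N₀.hasDerivAt x
  have hden : HasDerivAt (fun y : ℝ => y ^ w * f.eval y) (((w : ℕ) : ℝ) * x ^ (w - 1) * f.eval x + x ^ w * (derivative f).eval x) x :=
    (hasDerivAt_pow w x).mul (f.hasDerivAt x)
  refine ⟨_, ?_, hnum.div hden hV⟩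
  apply div_neg_of_neg_of_pos _ (by positivity)
  -- sparse forms
  have hN₀s : N₀ = ∑ i ∈ Finset.range (T + 1), C (c i * ((d i : ℝ) - d 0)) * X ^ (d i) := by
    rw [hN₀, hfdef]; exact euler_sparse (T + 1) d c _
  have hEs : X * derivative N₀ - C (((w : ℕ) : ℝ) + d 0) * N₀
      = ∑ i ∈ Finset.range (T + 1), C (c i * ((d i : ℝ) - d 0) * ((d i : ℝ) - ((w : ℝ) + d 0))) * X ^ (d i) := by
    rw [hN₀s]; exact euler_sparse (T + 1) d (fun i => c i * ((d i : ℝ) - d 0)) _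
  have hXf : x * (derivative f).eval x = N₀.eval x + (d 0 : ℝ) * f.eval x := by
    simp only [hN₀, eval_sub, eval_mul, eval_C, eval_X]; ring
  have evf : f.eval x = ∑ i ∈ Finset.range (T + 1), c i * x ^ (d i) := by
    rw [hfdef]; simp only [eval_finsetSum, eval_mul, eval_C, eval_pow, eval_X]
  have evN : N₀.eval x = ∑ i ∈ Finset.range (T + 1), ((d i : ℝ) - d 0) * (c i * x ^ (d i)) := by
    rw [hN₀s]; simp only [eval_finsetSum, eval_mul, eval_C, eval_pow, eval_X]
    exact Finset.sum_congr rfl fun i _ => by ring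
  have evE : (X * derivative N₀ - C (((w : ℕ) : ℝ) + d 0) * N₀).eval x
      = ∑ i ∈ Finset.range (T + 1), ((d i : ℝ) - d 0) * (((d i : ℝ) - d 0) - w) * (c i * x ^ (d i)) := by
    rw [hEs]; simp only [eval_finsetSum, eval_mul, eval_C, eval_pow, eval_X]
    exact Finset.sum_congr rfl fun i _ => by ring
  have evE' : (X * derivative N₀ - C (((w : ℕ) : ℝ) + d 0) * N₀).eval x
      = x * (derivative N₀).eval x - ((w : ℝ) + d 0) * N₀.eval x := by
    simp only [eval_sub, eval_mul, eval_C, eval_X]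
  -- `x · numerator = x^w · (f·E − N₀²)`
  have hkx : x * (((w : ℕ) : ℝ) * x ^ (w - 1)) = (w : ℝ) * x ^ w := by
    rcases Nat.eq_zero_or_pos w with h0 | hpos
    · rw [h0]; simp
    · rw [← Nat.sub_add_cancel hpos]; simp [pow_succ]; ring
  have hid : x * ((derivative N₀).eval x * (x ^ w * f.eval x)
        - N₀.eval x * (((w : ℕ) : ℝ) * x ^ (w - 1) * f.eval x + x ^ w * (derivative f).eval x))
      = x ^ w * (f.eval x * (X * derivative N₀ - C (((w : ℕ) : ℝ) + d 0) * N₀).eval x - (N₀.eval x) ^ 2) := by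
    rw [evE']
    linear_combination (-(N₀.eval x) * f.eval x) * hkx + (-(N₀.eval x) * x ^ w) * hXf
  -- the bracket is the coherent form, negative
  have hbr : f.eval x * (X * derivative N₀ - C (((w : ℕ) : ℝ) + d 0) * N₀).eval x - (N₀.eval x) ^ 2 < 0 := by
    rw [evf, evN, evE]
    rw [coherent_quadratic_identity (T + 1) (fun i => (d i : ℝ) - d 0) (fun i => c i * x ^ (d i)) (w : ℝ)]
    -- hypotheses of `coherent_form_neg`
    have hTm : T - 1 < T := by omega
    have hδw : ∀ l, l < T → ((d l : ℝ) - d 0) ≤ (w : ℝ) := by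
      intro l hl
      have hmono : d l ≤ d (T - 1) := hd.monotone (by omega)
      have := (Nat.cast_le.2 hmono : ((d l : ℕ) : ℝ) ≤ _)
      rw [hwR]; linarith
    have hwD : (w : ℝ) < (d T : ℝ) - d 0 := by
      have hlt : d (T - 1) < d T := hd hTm
      have := (Nat.cast_lt.2 hlt : ((d (T - 1) : ℕ) : ℝ) < _)
      rw [hwR]; linarith
    have hδ0 : ∀ l, l < T → (0 : ℝ) ≤ (d l : ℝ) - d 0 := by
      intro l _
      have := (Nat.cast_le.2 (hd.monotone (Nat.zero_le l)) : ((d 0 : ℕ) : ℝ) ≤ _)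
      linarith
    have hwpos : (0 : ℝ) < w := by
      have hlt : d 0 < d (T - 1) := hd (by omega)
      have := (Nat.cast_lt.2 hlt : ((d 0 : ℕ) : ℝ) < _)
      rw [hwR]; linarith
    have h1T : 1 ≤ T := by omega
    have hc0 : c 0 ≠ 0 := fun h => by rw [h, zero_mul] at htop; exact lt_irrefl 0 htop
    rcases lt_or_gt_of_ne hc0 with hc0 | hc0
    · -- c 0 < 0: use u = −c_i x^{d_i}
      have hneg := coherent_form_neg T h1T (fun i => (d i : ℝ) - d 0) (by simp) (w : ℝ) hwpos hδ0 hδw hwD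
        (fun i => -(c i * x ^ (d i))) (by have := mul_pos_of_neg_of_neg hc0 hc0; nlinarith [pow_pos hx (d 0)])
        (fun l hl => by have := hcoh l hl; nlinarith [pow_pos hx (d l)])
        (by nlinarith [pow_pos hx (d T)])
      simp only [neg_mul_neg] at hneg
      exact hneg
    · exact coherent_form_neg T h1T (fun i => (d i : ℝ) - d 0) (by simp) (w : ℝ) hwpos hδ0 hδw hwD
        (fun i => c i * x ^ (d i)) (by nlinarith [pow_pos hx (d 0)])
        (fun l hl => by have := hcoh l hl; nlinarith [pow_pos hx (d l)])
        (by nlinarith [pow_pos hx (d T)])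
  have hxw : 0 < x ^ w := pow_pos hx _
  have hlt : x * ((derivative N₀).eval x * (x ^ w * f.eval x)
        - N₀.eval x * (((w : ℕ) : ℝ) * x ^ (w - 1) * f.eval x + x ^ w * (derivative f).eval x)) < 0 := by
    rw [hid]; exact mul_neg_of_pos_of_neg hxw hbr
  by_contra hcon
  push Not at hcon
  exact absurd hlt (not_lt.2 (mul_nonneg hx.le hcon))

/-! ### §C A coherent factor has at most one positive zero; the product -/

/-- A coherent sparse factor is a nonzero polynomial with at most ONE positive zero (`f/x^{d_T}` is strictly monotone). [folklore] -/
theorem coherent_pos_roots_le_one (T : ℕ) (hT : 1 ≤ T) (d : ℕ → ℕ) (hd : StrictMono d) (c : ℕ → ℝ)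
    (hcoh : ∀ i, i < T → 0 < c 0 * c i) (htop : c 0 * c T < 0) :
    (∑ i ∈ Finset.range (T + 1), C (c i) * X ^ (d i) : ℝ[X]) ≠ 0 ∧
    (((∑ i ∈ Finset.range (T + 1), C (c i) * X ^ (d i) : ℝ[X])).roots.toFinset.filter (fun t => 0 < t)).card ≤ 1 := by
  classical
  have hc0 : c 0 ≠ 0 := fun h => by rw [h, zero_mul] at htop; exact lt_irrefl 0 htop
  have hcT : c T ≠ 0 := fun h => by rw [h, mul_zero] at htop; exact lt_irrefl 0 htop
  have hf0 := (sparse_leadingCoeff T d hd c hcT).2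
  refine ⟨hf0, ?_⟩
  -- `h(x) = Σ_{i<T} c_i / x^{d_T − d_i} + c_T` has the sign-definite strict monotonicity of `c_0`
  set h : ℝ → ℝ := fun x => ∑ i ∈ Finset.range T, c i / x ^ (d T - d i) with hh
  have hrel : ∀ z : ℝ, 0 < z → (∑ i ∈ Finset.range (T + 1), C (c i) * X ^ (d i) : ℝ[X]).eval z = z ^ (d T) * (h z + c T) := by
    intro z hz
    simp only [eval_finsetSum, eval_mul, eval_C, eval_pow, eval_X, hh]
    rw [Finset.sum_range_succ, mul_add, Finset.mul_sum]
    congr 1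
    swap
    · ring
    refine Finset.sum_congr rfl fun i hi => ?_
    rw [Finset.mem_range] at hi
    have hle : d i ≤ d T := hd.monotone hi.le
    have hzz : z ^ d i * z ^ (d T - d i) = z ^ d T := by rw [← pow_add, Nat.add_sub_cancel' hle]
    rw [mul_div_assoc', eq_div_iff (pow_ne_zero _ hz.ne')]
    linear_combination (c i) * hzz
  have hmono : ∀ x y : ℝ, 0 < x → x < y → c 0 * h y < c 0 * h x := by
    intro x y hx hxy
    rw [hh]; simp only [Finset.mul_sum]
    refine Finset.sum_lt_sum_of_nonempty ⟨0, by simp; omega⟩ fun i hi => ?_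
    rw [Finset.mem_range] at hi
    have hk : 1 ≤ d T - d i := Nat.sub_pos_of_lt (hd (by omega))
    have hpow : x ^ (d T - d i) < y ^ (d T - d i) := pow_lt_pow_left₀ hxy hx.le (by omega)
    have hci := hcoh i hi
    rw [mul_div_assoc', mul_div_assoc']
    exact div_lt_div_of_pos_left hci (pow_pos hx _) hpow
  rw [Finset.card_le_one]
  intro z₁ hz₁ z₂ hz₂
  rw [Finset.mem_filter, Multiset.mem_toFinset, mem_roots hf0, IsRoot.def] at hz₁ hz₂
  have e1 : h z₁ + c T = 0 := by
    have := hz₁.1; rw [hrel z₁ hz₁.2] at this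
    exact (mul_eq_zero.1 this).resolve_left (pow_ne_zero _ hz₁.2.ne')
  have e2 : h z₂ + c T = 0 := by
    have := hz₂.1; rw [hrel z₂ hz₂.2] at this
    exact (mul_eq_zero.1 this).resolve_left (pow_ne_zero _ hz₂.2.ne')
  have heq : h z₁ = h z₂ := by linarith
  by_contra hne
  rcases lt_or_gt_of_ne hne with hlt | hlt
  · have hm' := hmono z₁ z₂ hz₁.2 hlt; rw [heq] at hm'; exact lt_irrefl _ hm'
  · have hm' := hmono z₂ z₁ hz₂.2 hlt; rw [heq] at hm'; exact lt_irrefl _ hm'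

/-- The product of `m` coherent factors: nonzero, at most `m` positive zeros. [folklore] -/
theorem prod_coherent_pos_roots_le {m : ℕ} (T : ℕ) (hT : 1 ≤ T) (d : ℕ → ℕ) (hd : StrictMono d) (c : Fin m → ℕ → ℝ)
    (hcoh : ∀ j i, i < T → 0 < c j 0 * c j i) (htop : ∀ j, c j 0 * c j T < 0) :
    (∏ j, (∑ i ∈ Finset.range (T + 1), C (c j i) * X ^ (d i) : ℝ[X])) ≠ 0 ∧
    ((∏ j, (∑ i ∈ Finset.range (T + 1), C (c j i) * X ^ (d i) : ℝ[X])).roots.toFinset.filter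
      (fun t => 0 < t)).card ≤ m := by
  classical
  have hone := fun j => coherent_pos_roots_le_one T hT d hd (c j) (hcoh j) (htop j)
  have hP0 : (∏ j, (∑ i ∈ Finset.range (T + 1), C (c j i) * X ^ (d i) : ℝ[X])) ≠ 0 :=
    Finset.prod_ne_zero_iff.mpr (fun j _ => (hone j).1)
  refine ⟨hP0, ?_⟩
  have hsub : ((∏ j, (∑ i ∈ Finset.range (T + 1), C (c j i) * X ^ (d i) : ℝ[X])).roots.toFinset.filter (fun t => 0 < t))
      ⊆ Finset.univ.biUnion (fun j =>
        ((∑ i ∈ Finset.range (T + 1), C (c j i) * X ^ (d i) : ℝ[X]).roots.toFinset.filter (fun t => 0 < t))) := by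
    intro x hx
    rw [mem_filter, Multiset.mem_toFinset, mem_roots hP0, IsRoot.def, eval_prod, Finset.prod_eq_zero_iff] at hx
    obtain ⟨⟨j, _, hj⟩, hx0⟩ := hx
    rw [mem_biUnion]
    refine ⟨j, mem_univ _, ?_⟩
    rw [mem_filter, Multiset.mem_toFinset, mem_roots (hone j).1, IsRoot.def]
    exact ⟨hj, hx0⟩
  refine (card_le_card hsub).trans (card_biUnion_le.trans ?_)
  calc ∑ j, (((∑ i ∈ Finset.range (T + 1), C (c j i) * X ^ (d i) : ℝ[X]).roots.toFinset.filter (fun t => 0 < t))).card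
      ≤ ∑ _j : Fin m, 1 := Finset.sum_le_sum (fun j _ => (hone j).2)
    _ = m := by simp

/-! ### §D The Euler count: coherent members, every format -/

/-- ★ **Coherent `(T+1)`-nomials on a common support, bottom coupling**: `Z₊(X·P′ − (m·d_0)·P) ≤ 2m + 1` (`T ≥ 2`). [this file's theorem] -/
theorem coherentK_euler_pos_roots {m : ℕ} (T : ℕ) (hT : 2 ≤ T) (d : ℕ → ℕ) (hd : StrictMono d) (c : Fin m → ℕ → ℝ)
    (hcoh : ∀ j i, i < T → 0 < c j 0 * c j i) (htop : ∀ j, c j 0 * c j T < 0) :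
    ((X * derivative (∏ j, (∑ i ∈ Finset.range (T + 1), C (c j i) * X ^ (d i) : ℝ[X]))
        - C ((m : ℝ) * (d 0 : ℝ)) * ∏ j, (∑ i ∈ Finset.range (T + 1), C (c j i) * X ^ (d i) : ℝ[X])).roots.toFinset.filter
      (fun t => 0 < t)).card ≤ 2 * m + 1 := by
  classical
  rcases Nat.eq_zero_or_pos m with hm | hm
  · subst hm
    simp only [Finset.univ_eq_empty, Finset.prod_empty, derivative_one, mul_zero, zero_sub, mul_one, roots_neg,
      Nat.cast_zero, zero_mul, roots_C, Multiset.toFinset_zero, Finset.filter_empty, Finset.card_empty]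
    exact Nat.zero_le _
  obtain ⟨hP0, hZ⟩ := prod_coherent_pos_roots_le T (by omega) d hd c hcoh htop
  set w : ℕ := d (T - 1) - d 0 with hw
  -- the weighted level function `Ξ(y) = Σ_j N₀ⱼ(y) / (y^w f_j(y))`
  have h := euler_pos_roots_le_general (fun j => (∑ i ∈ Finset.range (T + 1), C (c j i) * X ^ (d i) : ℝ[X])) hP0
    ((m : ℝ) * (d 0 : ℝ)) m hZ ?_
  · exact h.trans (by omega)
  · intro w₁ w₂ hw₁ hw12 hfree h1 h2
    -- rewrite the level condition as `Ξ(w_i) = 0`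
    set Ξ : ℝ → ℝ := fun y => ∑ j, (X * derivative (∑ i ∈ Finset.range (T + 1), C (c j i) * X ^ (d i) : ℝ[X])
        - C ((d 0 : ℕ) : ℝ) * ∑ i ∈ Finset.range (T + 1), C (c j i) * X ^ (d i)).eval y
        / (y ^ (d (T - 1) - d 0) * (∑ i ∈ Finset.range (T + 1), C (c j i) * X ^ (d i) : ℝ[X]).eval y) with hΞ
    have hlevel : ∀ y : ℝ, 0 < y → (∀ j, (∑ i ∈ Finset.range (T + 1), C (c j i) * X ^ (d i) : ℝ[X]).eval y ≠ 0) →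
        (∑ j, y * (derivative (∑ i ∈ Finset.range (T + 1), C (c j i) * X ^ (d i) : ℝ[X])).eval y
            / (∑ i ∈ Finset.range (T + 1), C (c j i) * X ^ (d i) : ℝ[X]).eval y) = (m : ℝ) * (d 0 : ℝ) →
        Ξ y = 0 := by
      intro y hy hfy hl
      have hyw : y ^ (d (T - 1) - d 0) ≠ 0 := pow_ne_zero _ hy.ne'
      have key : Ξ y * y ^ (d (T - 1) - d 0)
          = (∑ j, y * (derivative (∑ i ∈ Finset.range (T + 1), C (c j i) * X ^ (d i) : ℝ[X])).eval y
            / (∑ i ∈ Finset.range (T + 1), C (c j i) * X ^ (d i) : ℝ[X]).eval y) - (m : ℝ) * (d 0 : ℝ) := by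
        rw [hΞ]; simp only
        rw [Finset.sum_mul]
        have : ((m : ℝ) * (d 0 : ℝ)) = ∑ _j : Fin m, ((d 0 : ℕ) : ℝ) := by simp
        rw [this, ← Finset.sum_sub_distrib]
        refine Finset.sum_congr rfl fun j _ => ?_
        have hfj := hfy j
        simp only [eval_sub, eval_mul, eval_X, eval_C]
        field_simp
      rw [hl, sub_self] at key
      exact (mul_eq_zero.1 key).resolve_right hyw
    have hΞ1 : Ξ w₁ = 0 := hlevel w₁ hw₁ (fun j => hfree w₁ ⟨le_rfl, hw12.le⟩ j) h1
    have hΞ2 : Ξ w₂ = 0 := hlevel w₂ (hw₁.trans hw12) (fun j => hfree w₂ ⟨hw12.le, le_rfl⟩ j) h2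
    -- `Ξ` has a negative derivative on `[w₁, w₂]`: Rolle gives a contradiction
    have hderiv : ∀ t ∈ Set.Icc w₁ w₂, ∃ D : ℝ, D < 0 ∧ HasDerivAt Ξ D t := by
      intro t ht
      have ht0 : 0 < t := hw₁.trans_le ht.1
      choose D hD using fun j => hasDerivAt_coherentXi_neg T hT d hd (c j) (hcoh j) (htop j) ht0 (hfree t ht j)
      refine ⟨∑ j, D j, Finset.sum_neg (fun j _ => (hD j).1) ⟨⟨0, hm⟩, Finset.mem_univ _⟩, ?_⟩
      have := HasDerivAt.fun_sum (u := Finset.univ) (fun j _ => (hD j).2)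
      rw [hΞ]; exact this
    have hcont : ContinuousOn Ξ (Set.Icc w₁ w₂) := fun t ht => by
      obtain ⟨D, _, hD⟩ := hderiv t ht
      exact hD.continuousAt.continuousWithinAt
    obtain ⟨ξ, hξ, hξ'⟩ := exists_deriv_eq_zero hw12 hcont (hΞ1.trans hΞ2.symm)
    obtain ⟨D, hDneg, hD⟩ := hderiv ξ ⟨hξ.1.le, hξ.2.le⟩
    rw [hD.deriv] at hξ'
    exact hDneg.ne hξ'

/-- ★★ **THE COHERENT ONE-ZERO SECTOR, EVERY FORMAT** (line shape; `3 ≤ K`, `d` strictly increasing, bottom coupling `l₀ = 0`, every factor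
with `a j 0 · a j l > 0` for `l < K−1` and `a j 0 · a j (K−1) < 0` — one sign change, at the top letter):
`Z₊(eulerNumerator d a 0) ≤ 2m + 1`. [this file's theorem] -/
theorem eulerBound_coherentK {m K : ℕ} (hK : 3 ≤ K) (d : Fin K → ℕ) (hd : StrictMono d) (a : Fin m → Fin K → ℝ)
    (hcoh : ∀ j (l : Fin K), (l : ℕ) < K - 1 → 0 < a j ⟨0, by omega⟩ * a j l)
    (htop : ∀ j, a j ⟨0, by omega⟩ * a j ⟨K - 1, by omega⟩ < 0) :
    ((∑ j, (∑ l, C (a j l * ((d l : ℝ) - d ⟨0, by omega⟩)) * X ^ (d l)) * ∏ i ∈ Finset.univ.erase j, (∑ l, C (a i l) * X ^ (d l))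
      : ℝ[X]).roots.toFinset.filter (fun t => 0 < t)).card ≤ 2 * m + 1 := by
  classical
  obtain ⟨K', rfl⟩ : ∃ K', K = K' + 1 := ⟨K - 1, by omega⟩
  have hK' : 2 ≤ K' := by omega
  set dx : ℕ → ℕ := fun i => if h : i < K' + 1 then d ⟨i, h⟩ else d ⟨K', by omega⟩ + (i - K') with hdx
  set cx : Fin m → ℕ → ℝ := fun j i => if h : i < K' + 1 then a j ⟨i, h⟩ else 0 with hcx
  have hdx_in : ∀ i (h : i < K' + 1), dx i = d ⟨i, h⟩ := fun i h => by simp only [hdx]; exact dif_pos h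
  have hdmono : StrictMono dx := by
    intro i j hij
    by_cases hj : j < K' + 1
    · have hi : i < K' + 1 := by omega
      rw [hdx_in i hi, hdx_in j hj]
      exact hd (Fin.mk_lt_mk.mpr hij)
    · have ej : dx j = d ⟨K', by omega⟩ + (j - K') := by simp only [hdx]; exact dif_neg hj
      rw [ej]
      by_cases hi : i < K' + 1
      · rw [hdx_in i hi]
        have : d ⟨i, hi⟩ ≤ d ⟨K', by omega⟩ := hd.monotone (Fin.mk_le_mk.mpr (by omega))
        omega
      · have ei : dx i = d ⟨K', by omega⟩ + (i - K') := by simp only [hdx]; exact dif_neg hi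
        rw [ei]
        omega
  have hfac : ∀ j, (∑ l, C (a j l) * X ^ (d l) : ℝ[X]) = ∑ i ∈ Finset.range (K' + 1), C (cx j i) * X ^ (dx i) := by
    intro j
    rw [← Fin.sum_univ_eq_sum_range (fun i => C (cx j i) * X ^ (dx i)) (K' + 1)]
    refine Finset.sum_congr rfl (fun l _ => ?_)
    have hl : (l : ℕ) < K' + 1 := l.isLt
    simp only [hcx, hdx, dif_pos hl, Fin.eta]
  have hcoh' : ∀ j i, i < K' → 0 < cx j 0 * cx j i := by
    intro j i hi
    simp only [hcx, dif_pos (show 0 < K' + 1 by omega), dif_pos (show i < K' + 1 by omega)]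
    exact hcoh j ⟨i, by omega⟩ (by simpa using hi)
  have htop' : ∀ j, cx j 0 * cx j K' < 0 := by
    intro j
    simp only [hcx, dif_pos (show 0 < K' + 1 by omega), dif_pos (show K' < K' + 1 by omega)]
    have := htop j
    simpa using this
  rw [eulerNumerator_eq_general, Finset.prod_congr rfl (fun j _ => hfac j)]
  have h0 : ((d ⟨0, by omega⟩ : ℕ) : ℝ) = (dx 0 : ℝ) := by rw [hdx_in 0 (by omega)]
  rw [h0]
  exact coherentK_euler_pos_roots K' hK' dx hdmono cx hcoh' htop'

end ProductPlusOne

end Summit.ValiantsHypothesis.ValiantsHypothesis.Theorems.LacunarySymmetroidMatrixDescartes
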